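import Summits.ResolutionOfSingularities.ResolutionOfSingularities.Theorems.MarkedTransferCampaignW24ReducedBridgeDigitOne
import Summits.ResolutionOfSingularities.ResolutionOfSingularities.Theorems.MarkedTransferCampaignW24ReducedRunParity
import Mathlib.Data.Finsupp.Lex
import HarnessLib

/-!
# The MIXED bridge, part 1: one-variable carriers `ε = E(x²) + x·G(x²)` with an EVEN PASSENGER `E` — datum analysis and one-step
# formulas (HIRONAKA-L · cell `res-hironaka` · slot W2.4, one-variable REDUCED MODEL ↔ the exit clause E3 at one carrier; generalises
# res-D-pv-020's `MarkedTransferCampaignW24ReducedBridge{,Run,DigitOne}.lean` from `Φ G` to `Ψ E + Φ G`)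

**HONEST FRAMING.** OURS throughout: kernel theorems connecting OURS objects of the cell (res-L1-k24's `CampaignW24.ReducedRun`,
res-type-059's `CampaignW24.stepAt` etc., res-D-pv-020's `CampaignW24.ReducedBridge`: `Ψ G = G(x²)`, `Φ G = x·G(x²)`). Nothing below is a
statement of H. Hironaka's manuscript [Hironaka2017] (lit key `paper:url-3343fd9e678b`), nothing asserts that any statement of it holds,
nothing is a claim about resolution of singularities in characteristic `p`, nothing is a verdict word; the manuscript stays «under review»
(D-0012/D-0089). AI work, weaker than expert review. Written by res-D-pv-020 (W2.4 lineage; own object 2026-08-27T12:06Z).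

## What is proved (`K` a field of characteristic `2`; `n = 1`, `p = 2`, `e = 1`)
* §1 `mix E G = Ψ E + Φ G`; every one-variable `F` is `mix (evenRead F) (oddRead F)`; coefficient / finiteness bookkeeping.
* §2 Lucas in char 2: `∂^{(e₀)}(Ψ E) = 0`, `∂^{(2k·e₀)}(Ψ E) = Ψ(D^{(k)}E)`; so `∂^{(e₀)}(mix E G) = Ψ G`, `∂^{(2k·e₀)}(mix E G) = Ψ(D^{(k)}E) + Φ(D^{(k)}G)`.
* §3 data of `mix E G` (`G ≠ 0`, `ord G = k`, depth `ℓ ≥ 1`): top pair `(e₀, 0)`, `γ_* = k·e₀`, `DepthBox ⟺ k < 2^{ℓ−1}`,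
  `u_* = Ψ(unitPart 2^{ℓ−1} k G)` under `SoleBottom` (class isolation reads ODD exponents only), `w = Ψ((unitPart …)⁻¹)`.
* §4 `stepAt_eq_mix_canonStepI` (`k ≥ 2`) and `stepAt_eq_mix_canonStepIIIone` (`k = 1`): `stepAt … = mix E′ (twin step of G)` for SOME
  passenger `E′` — the ODD PART steps exactly as the twin carrier does.
Consumer: `MarkedTransferCampaignW24ReducedBridgeMixedRun.lean` (runs, `StaysInBox`, the `n = 1, e = 1` slice of
⟨`Rescue.FiniteSupportStaysInBox_ours`⟩ at `p = 2`). Hypotheses: each theorem's own binders; no FACT-LIST fact, no DEFECT binder. Standard axioms.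
-/


noncomputable section

set_option linter.dupNamespace false -- mandated namespace of this single-conjunct summit

namespace Summit.ResolutionOfSingularities.ResolutionOfSingularities.Theorems

namespace CampaignW24

namespace ReducedBridge

open Literature.AlgebraicGeometry.Hironaka2017.S08UnitMonomial (StandardExpression)
open Literature.AlgebraicGeometry.Hironaka2017.S09LLUED
open Literature.AlgebraicGeometry.Hironaka2017.S09LLUED.TopFrontier
open Literature.AlgebraicGeometry.Hironaka2017.S09LLUED.TopDeriv
open Literature.RingTheory.MvPowerSeries (hasseDeriv coeff_hasseDeriv)
open CampaignW21 (xs hasseD)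

variable {K : Type} [Field K]

/-! ## §1 Mixed carriers `Ψ E + Φ G` -/

/-- [OURS · W2.4 bridge] `mix E G = Ψ E + Φ G = E(x²) + x·G(x²)`. Bookkeeping definition. [folklore] -/
def mix (E G : PowerSeries K) : MvPowerSeries (Fin 1) K := psi E + phi G

/-- [OURS · W2.4 bridge] the even part read off a one-variable series: `coeff_j (evenRead F) = coeff_{2j} F`. [folklore] -/
def evenRead (F : MvPowerSeries (Fin 1) K) : PowerSeries K :=
  PowerSeries.mk fun j => MvPowerSeries.coeff (Finsupp.single 0 (2 * j)) F

/-- [OURS · W2.4 bridge] the odd part read off a one-variable series: `coeff_j (oddRead F) = coeff_{2j+1} F`. [folklore] -/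
def oddRead (F : MvPowerSeries (Fin 1) K) : PowerSeries K :=
  PowerSeries.mk fun j => MvPowerSeries.coeff (Finsupp.single 0 (2 * j + 1)) F

/-- Coefficients of a mixed carrier: even exponents read `E`, odd exponents read `G`. [folklore] -/
theorem coeff_mix (E G : PowerSeries K) (d : Fin 1 →₀ ℕ) :
    MvPowerSeries.coeff d (mix E G) = if 2 ∣ d 0 then PowerSeries.coeff (d 0 / 2) E else PowerSeries.coeff (d 0 / 2) G := by
  rw [mix, map_add, coeff_psi, coeff_phi]
  split_ifs <;> simp

/-- Odd coefficients of a mixed carrier. [folklore] -/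
theorem coeff_mix_two_mul_add_one (E G : PowerSeries K) (m : ℕ) :
    MvPowerSeries.coeff (Finsupp.single 0 (2 * m + 1)) (mix E G) = PowerSeries.coeff m G := by
  rw [coeff_mix, Finsupp.single_eq_same, if_neg (by omega), show (2 * m + 1) / 2 = m by omega]

/-- Even coefficients of a mixed carrier. [folklore] -/
theorem coeff_mix_two_mul (E G : PowerSeries K) (m : ℕ) :
    MvPowerSeries.coeff (Finsupp.single 0 (2 * m)) (mix E G) = PowerSeries.coeff m E := by
  rw [coeff_mix, Finsupp.single_eq_same, if_pos (dvd_mul_right 2 m), Nat.mul_div_cancel_left _ two_pos]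

/-- **Every one-variable series is a mixed carrier**: `F = mix (evenRead F) (oddRead F)`. [folklore] -/
theorem mix_evenRead_oddRead (F : MvPowerSeries (Fin 1) K) : mix (evenRead F) (oddRead F) = F := by
  ext d
  rw [coeff_mix]
  split_ifs with h
  · obtain ⟨j, hj⟩ := h
    rw [evenRead, PowerSeries.coeff_mk, hj, Nat.mul_div_cancel_left _ two_pos, eq_single d, hj]
  · obtain ⟨j, hj⟩ : ∃ j, d 0 = 2 * j + 1 := ⟨d 0 / 2, by omega⟩
    rw [oddRead, PowerSeries.coeff_mk, show d 0 / 2 = j by omega, eq_single d, hj]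

/-! ## §2 Hasse derivatives of `Ψ E` and of `mix E G` in characteristic 2 -/

section Hasse

variable [CharP K 2]

/-- `∂^{(e₀)}(Ψ E) = 0` in characteristic 2 (`C(2j, 1) = 2j ≡ 0`). [folklore] -/
theorem hasseD_one_psi (E : PowerSeries K) : hasseD K 1 (Finsupp.single 0 1) (psi E) = 0 := by
  ext d
  rw [MvPowerSeries.coeff_zero]
  show MvPowerSeries.coeff d (hasseDeriv (Finsupp.single 0 1) (psi E)) = 0
  rw [coeff_hasseDeriv, prod_choose_fin_one, Finsupp.single_eq_same, Nat.choose_one_right, coeff_psi]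
  simp only [Finsupp.add_apply, Finsupp.single_eq_same]
  by_cases h : 2 ∣ d 0
  · rw [if_neg (by omega), mul_zero]
  · rw [if_pos (by omega)]
    obtain ⟨m, hm⟩ : ∃ m, 1 + d 0 = 2 * m := ⟨(1 + d 0) / 2, by omega⟩
    rw [hm, Nat.cast_mul, CharP.cast_eq_zero K 2, zero_mul, zero_mul]

/-- `∂^{(2k·e₀)}(Ψ E) = Ψ(D^{(k)}E)` in characteristic 2 (Lucas: `C(2m, 2k) ≡ C(m, k)`). [folklore] -/
theorem hasseD_two_mul_psi (E : PowerSeries K) (k : ℕ) :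
    hasseD K 1 (Finsupp.single 0 (2 * k)) (psi E) = psi (ReducedRun.D k E) := by
  ext d
  show MvPowerSeries.coeff d (hasseDeriv (Finsupp.single 0 (2 * k)) (psi E)) = _
  rw [coeff_hasseDeriv, prod_choose_fin_one, Finsupp.single_eq_same, coeff_psi, coeff_psi]
  simp only [Finsupp.add_apply, Finsupp.single_eq_same]
  by_cases h : 2 ∣ d 0
  · obtain ⟨m, hm⟩ := h
    rw [if_pos (by omega), if_pos ⟨m, hm⟩, ReducedRun.coeff_D, hm,
      show 2 * k + 2 * m = 2 * (m + k) by ring, Nat.mul_div_cancel_left _ two_pos, Nat.mul_div_cancel_left _ two_pos,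
      ReducedRun.natCast_choose_two_mul_two_mul]
  · rw [if_neg (by omega), if_neg h, mul_zero]

/-- **`∂^{(e₀)}(mix E G) = Ψ G`**: the even passenger is invisible to `∂^{(e₀)}`. [folklore] -/
theorem hasseD_one_mix (E G : PowerSeries K) : hasseD K 1 (Finsupp.single 0 1) (mix E G) = psi G := by
  have h1 := hasseD_one_psi E
  have h2 := hasseD_one_phi G
  change hasseDeriv (Finsupp.single 0 1) (psi E) = 0 at h1
  change hasseDeriv (Finsupp.single 0 1) (phi G) = psi G at h2
  show hasseDeriv (Finsupp.single 0 1) (psi E + phi G) = psi G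
  rw [map_add, h1, h2, zero_add]

/-- **`∂^{(2k·e₀)}(mix E G) = Ψ(D^{(k)}E) + Φ(D^{(k)}G)`**. [folklore] -/
theorem hasseD_two_mul_mix (E G : PowerSeries K) (k : ℕ) :
    hasseD K 1 (Finsupp.single 0 (2 * k)) (mix E G) = psi (ReducedRun.D k E) + phi (ReducedRun.D k G) := by
  have h1 := hasseD_two_mul_psi E k
  have h2 := hasseD_two_mul_phi G k
  change hasseDeriv (Finsupp.single 0 (2 * k)) (psi E) = _ at h1
  change hasseDeriv (Finsupp.single 0 (2 * k)) (phi G) = _ at h2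
  show hasseDeriv (Finsupp.single 0 (2 * k)) (psi E + phi G) = _
  rw [map_add, h1, h2]

end Hasse

/-! ## §3 Datum analysis for `mix E G` (`G ≠ 0`) -/

section Datum

variable [CharP K 2] {ℓ : ℕ} {F : MvPowerSeries (Fin 1) K} {E G : PowerSeries K}

/-- Every datum of `mix E G` with `G ≠ 0` has top pair `(e₀, 0)` (an odd monomial is visible; `pairKey_le_top`). [folklore] -/
theorem alpha_eq_single_mix (X : StandardExpression 2 (xs K 1) 1 ℓ F) (hF : F = mix E G) (hℓ : 1 ≤ ℓ) (hG : G ≠ 0) :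
    alpha X.support X.u = Finsupp.single 0 1 ∧ beta X.support X.u = 0 := by
  subst hF
  obtain ⟨k, hk⟩ : ∃ k, PowerSeries.coeff k G ≠ 0 := by
    by_contra h
    push Not at h
    exact hG (PowerSeries.ext fun k => by rw [h k, map_zero])
  have hc : MvPowerSeries.coeff (Finsupp.single 0 (2 * k + 1)) (mix E G) ≠ 0 := by rwa [coeff_mix_two_mul_add_one]
  obtain ⟨s, hs, r, hr⟩ := exists_mem_effSupport_of_coeff_ne_zero hℓ X hc
  have hss := (mem_effSupport.mp hs).1
  have hβ : beta X.support X.u = 0 := by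
    obtain ⟨t, ht, -, h2⟩ := exists_top_of_nonempty ⟨s, hs⟩
    obtain ⟨hts, -⟩ := mem_effSupport.mp ht
    rw [← h2, eq_single t.2.1]
    have := X.b_lt _ hts 0
    simp only [Nat.sub_self, pow_zero, Nat.lt_one_iff] at this
    rw [this, Finsupp.single_zero]
  have hb : s.2.1 = 0 := by
    rw [eq_single s.2.1]
    have := X.b_lt _ hss 0
    simp only [Nat.sub_self, pow_zero, Nat.lt_one_iff] at this
    rw [this, Finsupp.single_zero]
  have ha1 : s.1 0 = 1 := by
    have ha2 : s.1 0 < 2 := X.a_lt _ hss 0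
    have h := congr_arg (fun f : Fin 1 →₀ ℕ => f 0) hr
    simp only [Finsupp.single_eq_same, Finsupp.add_apply, Finsupp.smul_apply, smul_eq_mul, hb, Finsupp.coe_zero,
      Pi.zero_apply, mul_zero, add_zero, pow_one] at h
    omega
  refine ⟨?_, hβ⟩
  have hαlt : alpha X.support X.u 0 < 2 := by
    obtain ⟨t, ht, h1, -⟩ := exists_top_of_nonempty ⟨s, hs⟩
    rw [← h1]
    exact X.a_lt _ (mem_effSupport.mp ht).1 0
  have hle := pairKey_le_top hs
  have hge : s.1 0 ≤ alpha X.support X.u 0 := by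
    rcases Prod.Lex.toLex_le_toLex.mp hle with hlt | ⟨heq, -⟩
    · have := Finsupp.Lex.lt_iff_of_unique.mp hlt
      have hd : (default : Fin 1) = 0 := Subsingleton.elim _ _
      rw [hd] at this
      exact le_of_lt this
    · exact le_of_eq (congr_arg (fun f : Fin 1 →₀ ℕ => f 0) (toLex_inj.mp heq))
  rw [eq_single (alpha X.support X.u)]
  congr 1
  omega

/-- Every datum of `mix E G` (`ord G = k`) with non-empty top block has `γ_* = k·e₀` (only ODD exponents are read). [folklore] -/
theorem gammaStar_eq_single_mix (X : StandardExpression 2 (xs K 1) 1 ℓ F) (hF : F = mix E G) (hℓ : 1 ≤ ℓ)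
    (h0 : 0 < frontierLength X.support X.u) {k : ℕ} (hk : PowerSeries.order G = k) :
    gammaStar X.support X.u = Finsupp.single 0 k := by
  have hG : G ≠ 0 := fun h => by rw [h, PowerSeries.order_zero] at hk; exact ENat.top_ne_coe k hk
  obtain ⟨hα, hβ⟩ := alpha_eq_single_mix X hF hℓ hG
  subst hF
  obtain ⟨hk0, hklt⟩ := PowerSeries.order_eq_nat.mp hk
  have hc := coeff_bottomExp_ne_zero X Nat.one_pos hℓ h0
  have hbot : bottomExp 2 1 X.support X.u = Finsupp.single 0 (2 * gammaStar X.support X.u 0 + 1) := by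
    rw [bottomExp, hα, hβ, eq_single (gammaStar X.support X.u)]
    refine Finsupp.ext fun s => ?_
    have hs : s = 0 := Subsingleton.elim _ _
    subst hs
    simp only [Finsupp.add_apply, Finsupp.smul_apply, Finsupp.single_eq_same, smul_eq_mul, smul_zero,
      Finsupp.coe_zero, Pi.zero_apply]
    omega
  rw [hbot, coeff_mix_two_mul_add_one] at hc
  have h1 : k ≤ gammaStar X.support X.u 0 := by
    by_contra hlt
    exact hc (hklt _ (by omega))
  have h2 := toLex_gammaStar_le_of_coeff_ne_zero X Nat.one_pos hℓ h0 (c := Finsupp.single 0 k) (by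
    have : topFrontierExp 2 X.support X.u + 2 ^ 1 • Finsupp.single 0 k = Finsupp.single 0 (2 * k + 1) := by
      rw [topFrontierExp, hα, hβ]
      refine Finsupp.ext fun s => ?_
      have hs : s = 0 := Subsingleton.elim _ _
      subst hs
      simp only [Finsupp.add_apply, Finsupp.smul_apply, Finsupp.single_eq_same, smul_eq_mul, smul_zero,
        Finsupp.coe_zero, Pi.zero_apply]
      omega
    rw [this, coeff_mix_two_mul_add_one]
    exact hk0)
  have h3 : Finsupp.single 0 k ≤ gammaStar X.support X.u := by
    intro s
    have hs : s = 0 := Subsingleton.elim _ _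
    subst hs
    simpa using h1
  have h4 : toLex (Finsupp.single (0 : Fin 1) k) = toLex (gammaStar X.support X.u) :=
    le_antisymm (Finsupp.toLex_monotone h3) h2
  exact (toLex_inj.mp h4).symm

/-- For a datum of `mix E G` (`ord G = k`): `DepthBox ⟺ k < 2^{ℓ−1}`. [folklore] -/
theorem depthBox_iff_mix (X : StandardExpression 2 (xs K 1) 1 ℓ F) (hF : F = mix E G) (hℓ : 1 ≤ ℓ)
    (h0 : 0 < frontierLength X.support X.u) {k : ℕ} (hk : PowerSeries.order G = k) :
    DepthBox 2 1 ℓ X.support X.u ↔ k < 2 ^ (ℓ - 1) := by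
  rw [DepthBox, gammaStar_eq_single_mix X hF hℓ h0 hk]
  have h2 : 2 ^ ℓ = 2 * 2 ^ (ℓ - 1) := by
    rw [← pow_succ', Nat.sub_add_cancel hℓ]
  constructor
  · intro h
    have := h 0
    simp only [Finsupp.smul_apply, Finsupp.single_eq_same, smul_eq_mul, pow_one] at this
    omega
  · intro h s
    have hs : s = 0 := Subsingleton.elim _ _
    subst hs
    simp only [Finsupp.smul_apply, Finsupp.single_eq_same, smul_eq_mul, pow_one]
    omega

/-- For a datum of `mix E G` in `SoleBottom` (`ord G = k`): `u_* = Ψ (unitPart 2^{ℓ−1} k G)` (the bottom class is ODD). [folklore] -/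
theorem uStar_eq_psi_unitPart_mix (X : StandardExpression 2 (xs K 1) 1 ℓ F) (hF : F = mix E G) (hℓ : 1 ≤ ℓ)
    (h0 : 0 < frontierLength X.support X.u) {k : ℕ} (hk : PowerSeries.order G = k)
    (hsole : SoleBottom 2 1 ℓ X.support X.u) :
    uStar X.support X.u = psi (ReducedRun.unitPart (2 ^ (ℓ - 1)) k G) := by
  have hG : G ≠ 0 := fun h => by rw [h, PowerSeries.order_zero] at hk; exact ENat.top_ne_coe k hk
  obtain ⟨hα, hβ⟩ := alpha_eq_single_mix X hF hℓ hG
  have hγ := gammaStar_eq_single_mix X hF hℓ h0 hk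
  subst hF
  have h2 : 2 ^ ℓ = 2 * 2 ^ (ℓ - 1) := by
    rw [← pow_succ', Nat.sub_add_cancel hℓ]
  ext d
  by_cases hd : 2 ^ ℓ ∣ d 0
  · obtain ⟨m, hm⟩ := hd
    have hdμ : d = 2 ^ ℓ • Finsupp.single 0 m := by
      rw [eq_single d, hm, Finsupp.smul_single, smul_eq_mul]
    have h1 := coeff_bottomExp_add_eq_coeff_uStar X Nat.one_pos hℓ h0 hsole (Finsupp.single 0 m)
    rw [← hdμ] at h1
    rw [← h1]
    have h3 : bottomExp 2 1 X.support X.u + d = Finsupp.single 0 (2 * (2 ^ (ℓ - 1) * m + k) + 1) := by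
      rw [bottomExp, hα, hβ, hγ, eq_single d, hm, h2]
      refine Finsupp.ext fun s => ?_
      have hs : s = 0 := Subsingleton.elim _ _
      subst hs
      simp only [Finsupp.add_apply, Finsupp.smul_apply, Finsupp.single_eq_same, smul_eq_mul, smul_zero,
        Finsupp.coe_zero, Pi.zero_apply, pow_one]
      ring
    have h4 : d = Finsupp.single 0 (2 * (2 ^ (ℓ - 1) * m)) := by
      rw [eq_single d, hm, h2, mul_assoc]
    rw [h3, coeff_mix_two_mul_add_one, h4, coeff_psi_two_mul, ReducedRun.coeff_unitPart, if_pos (dvd_mul_right _ _)]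
  · rw [coeff_uStar_eq_zero_of_not_dvd X h0 ⟨0, hd⟩, coeff_psi]
    split_ifs with h2d
    · obtain ⟨m, hm⟩ := h2d
      rw [hm, Nat.mul_div_cancel_left _ Nat.two_pos, ReducedRun.coeff_unitPart, if_neg]
      intro hPm
      apply hd
      rw [hm, h2]
      exact Nat.mul_dvd_mul_left 2 hPm
    · rfl

/-- A legal inverse of `u_*` on a datum of `mix E G` in `SoleBottom` is `Ψ ((unitPart …)⁻¹)`. [folklore] -/
theorem eq_psi_inv_unitPart_mix (X : StandardExpression 2 (xs K 1) 1 ℓ F) (hF : F = mix E G) (hℓ : 1 ≤ ℓ)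
    (h0 : 0 < frontierLength X.support X.u) {k : ℕ} (hk : PowerSeries.order G = k)
    (hsole : SoleBottom 2 1 ℓ X.support X.u) {w : MvPowerSeries (Fin 1) K} (hw : w * uStar X.support X.u = 1) :
    w = psi (ReducedRun.unitPart (2 ^ (ℓ - 1)) k G)⁻¹ := by
  set u := ReducedRun.unitPart (2 ^ (ℓ - 1)) k G with hu
  have hu0 : PowerSeries.constantCoeff u ≠ 0 := by
    rw [hu, ReducedRun.constantCoeff_unitPart]
    exact (PowerSeries.order_eq_nat.mp hk).1
  have hinv : psi u * psi u⁻¹ = 1 := by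
    rw [← map_mul, PowerSeries.mul_inv_cancel u hu0, map_one]
  rw [uStar_eq_psi_unitPart_mix X hF hℓ h0 hk hsole] at hw
  calc w = w * (psi u * psi u⁻¹) := by rw [hinv, mul_one]
    _ = psi u⁻¹ := by rw [← mul_assoc, hw, one_mul]

end Datum

/-! ## §4 One-step formulas: the odd part steps as the twin does, the even part is a passenger -/

section Step

variable [CharP K 2] {ℓ : ℕ} {F : MvPowerSeries (Fin 1) K} {E G : PowerSeries K}

/-- **Case (I) step, operator form**: `F − opI(w; e₀, 0, k·e₀) F = mix (E − u⁻¹·G·D^{(k)}E) (canonStepI 2^{ℓ−1} G)`. [folklore] -/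
theorem sub_opI_eq_mix (X : StandardExpression 2 (xs K 1) 1 ℓ F) (hF : F = mix E G) (hℓ : 1 ≤ ℓ)
    (h0 : 0 < frontierLength X.support X.u) {k : ℕ} (hk : PowerSeries.order G = k)
    (hsole : SoleBottom 2 1 ℓ X.support X.u) {w : MvPowerSeries (Fin 1) K} (hw : w * uStar X.support X.u = 1) :
    F - opI (hasseD K 1) w 2 (2 ^ 1) (Finsupp.single 0 1) 0 (Finsupp.single 0 k) F =
      mix (E - (ReducedRun.unitPart (2 ^ (ℓ - 1)) k G)⁻¹ * (G * ReducedRun.D k E))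
        (ReducedRun.canonStepI (2 ^ (ℓ - 1)) G) := by
  have hwinv := eq_psi_inv_unitPart_mix X hF hℓ h0 hk hsole hw
  subst hF
  have hkn : (PowerSeries.order G).toNat = k := by rw [hk]; rfl
  rw [opI, HFlat.pre, smul_zero, add_zero, Finsupp.smul_single, smul_eq_mul, pow_one, hasseD_one_mix, hasseD_two_mul_mix,
    ReducedRun.canonStepI, hkn, ReducedRun.stepI, hwinv, mix, mix, map_sub, map_mul, map_mul, phi_sub, phi_mul, phi_mul]
  rw [mul_add, ← map_mul, ← phi_mul, mul_add, ← map_mul, ← phi_mul]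
  ring

/-- **Case (I) step at bottom digit `k ≥ 2`** (any case witness): `stepAt … = mix E′ (canonStepI 2^{ℓ−1} G)` — the ODD PART steps
exactly as the twin carrier does. [folklore] -/
theorem stepAt_eq_mix_canonStepI (X : StandardExpression 2 (xs K 1) 1 ℓ F) (hF : F = mix E G) (hℓ : 1 ≤ ℓ)
    (h0 : 0 < frontierLength X.support X.u) {k : ℕ} (hk : PowerSeries.order G = k) (h2k : 2 ≤ k)
    (hsole : SoleBottom 2 1 ℓ X.support X.u) {w : MvPowerSeries (Fin 1) K} (hw : w * uStar X.support X.u = 1)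
    (c : HFlat.Case 2 (2 ^ 1) (alpha X.support X.u) (beta X.support X.u) (gammaStar X.support X.u)) :
    ∃ E' : PowerSeries K, stepAt (xs K 1) (hasseD K 1) X w c = mix E' (ReducedRun.canonStepI (2 ^ (ℓ - 1)) G) := by
  have hG : G ≠ 0 := fun h => by rw [h, PowerSeries.order_zero] at hk; exact ENat.top_ne_coe k hk
  obtain ⟨hα, hβ⟩ := alpha_eq_single_mix X hF hℓ hG
  have hγ := gammaStar_eq_single_mix X hF hℓ h0 hk
  have hII : ¬ IsCaseII 2 (2 ^ 1) (alpha X.support X.u) (beta X.support X.u) := by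
    rw [hα, hβ]; exact not_isCaseII
  have hIII : ¬ IsCaseIII 2 (2 ^ 1) (alpha X.support X.u) (beta X.support X.u) (gammaStar X.support X.u) := by
    rw [hα, hβ, hγ]; exact not_isCaseIII h2k
  have key := sub_opI_eq_mix X hF hℓ h0 hk hsole hw
  subst hF
  refine ⟨E - (ReducedRun.unitPart (2 ^ (ℓ - 1)) k G)⁻¹ * (G * ReducedRun.D k E), ?_⟩
  show mix E G - op (xs K 1) (hasseD K 1) w 2 (2 ^ 1) _ _ _ c (mix E G) = _
  rw [op_eq_opI _ _ _ _ _ _ _ _ c hII hIII, hα, hβ, hγ]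
  exact key

/-- **`h♭` on a mixed carrier**: `h♭(mix A B) = mix (B·D^{(1)}A) (twinPre B)`. [folklore] -/
theorem pre_mix (A B : PowerSeries K) :
    HFlat.pre (hasseD K 1) 2 (2 ^ 1) (Finsupp.single 0 1) 0 (Finsupp.single 0 1) (mix A B) =
      mix (B * ReducedRun.D 1 A) (ReducedRun.twinPre B) := by
  rw [HFlat.pre, smul_zero, add_zero, Finsupp.smul_single, smul_eq_mul, pow_one, hasseD_one_mix, hasseD_two_mul_mix, mix,
    mul_add, ← map_mul, ← phi_mul, ReducedRun.twinPre]

/-- Iterates of `h♭` on a mixed carrier: the odd part is `twinPre^{[j]} B`, the even part SOME passenger. [folklore] -/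
theorem pre_iterate_mix (B : PowerSeries K) : ∀ (j : ℕ) (A : PowerSeries K), ∃ A' : PowerSeries K,
    (HFlat.pre (hasseD K 1) 2 (2 ^ 1) (Finsupp.single 0 1) 0 (Finsupp.single 0 1))^[j] (mix A B) =
      mix A' (ReducedRun.twinPre^[j] B)
  | 0, A => ⟨A, rfl⟩
  | j + 1, A => by
    obtain ⟨A', hA'⟩ := pre_iterate_mix (ReducedRun.twinPre B) j (B * ReducedRun.D 1 A)
    refine ⟨A', ?_⟩
    rw [Function.iterate_succ_apply, pre_mix, hA', Function.iterate_succ_apply]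

/-- **Case (III) step at bottom digit 1** (any case witness, necessarily Case (III)): `stepAt … = mix E′ (canonStepIIIone 2^{ℓ−1} G)`
— the odd part takes the digit-1 step of `…ReducedBridgeDigitOne.lean`. [folklore] -/
theorem stepAt_eq_mix_canonStepIIIone (X : StandardExpression 2 (xs K 1) 1 ℓ F) (hF : F = mix E G) (hℓ : 1 ≤ ℓ)
    (h0 : 0 < frontierLength X.support X.u) (hk : PowerSeries.order G = (1 : ℕ))
    (hsole : SoleBottom 2 1 ℓ X.support X.u) {w : MvPowerSeries (Fin 1) K} (hw : w * uStar X.support X.u = 1)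
    (c : HFlat.Case 2 (2 ^ 1) (alpha X.support X.u) (beta X.support X.u) (gammaStar X.support X.u)) :
    ∃ E' : PowerSeries K, stepAt (xs K 1) (hasseD K 1) X w c = mix E' (ReducedRun.canonStepIIIone (2 ^ (ℓ - 1)) G) := by
  have hG : G ≠ 0 := fun h => by rw [h, PowerSeries.order_zero] at hk; exact ENat.top_ne_coe _ hk
  obtain ⟨hα, hβ⟩ := alpha_eq_single_mix X hF hℓ hG
  have hγ := gammaStar_eq_single_mix X hF hℓ h0 hk
  have hI : ¬ IsCaseI (2 ^ 1) (gammaStar X.support X.u) := by rw [hγ]; exact not_isCaseI_digitOne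
  have hII : ¬ IsCaseII 2 (2 ^ 1) (alpha X.support X.u) (beta X.support X.u) := by
    rw [hα, hβ]; exact not_isCaseII
  have hwinv := eq_psi_inv_unitPart_mix X hF hℓ h0 hk hsole hw
  obtain ⟨A₃, hA₃⟩ := pre_iterate_mix G 3 E
  subst hF
  refine ⟨E - (ReducedRun.unitPart (2 ^ (ℓ - 1)) 1 G)⁻¹ ^ 7 * A₃, ?_⟩
  show mix E G - op (xs K 1) (hasseD K 1) w 2 (2 ^ 1) _ _ _ c (mix E G) = _
  rw [op_eq_opIII _ _ _ _ _ _ _ _ c hI hII, hα, hβ, hγ, opIII, HFlat.caseIII, kBar_digitOne, hA₃, hwinv, ← map_pow,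
    ReducedRun.canonStepIIIone]
  simp only [mix, map_sub, map_mul, phi_sub, phi_mul]
  ring

end Step

end ReducedBridge

end CampaignW24

end Summit.ResolutionOfSingularities.ResolutionOfSingularities.Theorems

end
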